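import Literature.RepresentationTheory.BorelWallach2000.UpqCasimirTensor   -- ★ `upqCasimirOp`, `upqCasimirOp_eq` (`C = Σ_s ρ(x_s)² − Σ_a ρ(w_a)²`)
import HarnessLib

/-!
# The Casimir identity in form-norms: `Σ_s ‖ρ(x_s) u‖² = −Re c · ‖u‖² + Σ_a ‖ρ(w_a) u‖²` for a skew action of `𝔲(α, β)` with scalar Casimir

Topic `NumberTheory/Automorphic`; namespace `Literature.NumberTheory.Automorphic`; THEOREMS ONLY (no `def`, no named fact, no instance, no notation, no `sorry`).
Cell `hodgecm-mathlib`, F0∕P3, T1a arch line, ROAD-GLOB (A6 #92 at `U(2,1)`), brick «FB», piece **T4a** (A-p06 (g24) plan 2026-08-31): the `𝔭`-letters of the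
degree bound G1 are controlled by the `𝔨`-letters through the Casimir.  For a `(𝔤, K)`-module of `U(α, β)` whose `𝔤`-action is SKEW for a sesquilinear form `B`
(the `IsInfUnitary` form) and whose Casimir ★ `upqCasimirOp ρ𝔤` acts by the scalar `c` (Schur ∕ Dixmier ★ N0), for every vector `u`:
`Σ_s B (ρ(x_s) u) (ρ(x_s) u) = −c · B u u + Σ_a B (ρ(w_a) u) (ρ(w_a) u)` over the Cartan frame `(x_s)` of `𝔭` and the pseudo-orthonormal frame `(w_a)` of `𝔨`
(★ `upqCasimirOp_eq`: `C = Σ_s ρ(x_s)² − Σ_a ρ(w_a)²`; skewness `B (D u) (D u) = −B u (D (D u))`).  Real parts: **`upq_sum_re_form_pPart_eq`**; and the one-letter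
consequence **`re_form_upqPBasis_le`**: `Re B (ρ(x_s) u) (ρ(x_s) u) ≤ −Re c · Re B u u + Σ_a Re B (ρ(w_a) u) (ρ(w_a) u)` (each term `Re B (D u) (D u) ≥ 0`).
[BorelWallach2000, II §1.3 (1)–(2)]; [HarishChandra1953, §9]; [Nelson1959, §2 (domination of `Σ X_i²` by the Laplacian)].
HONEST LABEL: closes no registered stub by itself.  HC_CM is proved only modulo the 2 remaining named inputs (hLiu418, h413) until rung 0 closes.

## References
* A. Borel, N. Wallach, *Continuous cohomology, discrete subgroups, and representations of reductive groups*, 2nd ed. (2000), II §1.3 [BorelWallach2000].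
* Harish-Chandra, *Representations of a semisimple Lie group on a Banach space. I*, Trans. AMS 75 (1953), §9 [HarishChandra1953].
* E. Nelson, *Analytic vectors*, Ann. of Math. 70 (1959), §2 [Nelson1959].
-/

-- Mathlib idiom (as in ★ `GKModules`, ★ `UpqCasimirTensor`): the commutator bracket on `Module.End ℂ V`, to MENTION `ρ𝔤 : 𝔤 →ₗ⁅ℝ⁆ End V`.
attribute [local instance 100] LieRing.ofAssociativeRing

set_option autoImplicit false

noncomputable section

namespace Literature.NumberTheory.Automorphic

open Literature.RepresentationTheory.KonnoKonno2007 Literature.RepresentationTheory.KonnoKonno2007.RealDualPair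
open Literature.RepresentationTheory.BorelWallach2000

variable {α β : Type*} [Fintype α] [DecidableEq α] [Fintype β] [DecidableEq β]
variable {V : Type*} [AddCommGroup V] [Module ℂ V] (ρ𝔤 : (uFormGroup α β).lie →ₗ⁅ℝ⁆ Module.End ℂ V)

/-- Skewness read on squares: `B (D u) (D u) = −B u (D (D u))`. [cite: BorelWallach2000, II §1.3] -/
theorem form_apply_apply_eq_neg (B : V →ₗ⋆[ℂ] V →ₗ[ℂ] ℂ) (D : Module.End ℂ V) (hD : ∀ x y, B (D x) y = -B x (D y)) (u : V) :
    B (D u) (D u) = -B u ((D * D) u) := by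
  rw [hD, Module.End.mul_apply]

/-- **THE CASIMIR IDENTITY IN FORM-NORMS.**  If every `ρ𝔤(Y)` is `B`-skew and the Casimir acts on `u` by `C u = c • u`, then
`Σ_s B (ρ(x_s) u) (ρ(x_s) u) = −c · B u u + Σ_a B (ρ(w_a) u) (ρ(w_a) u)`. [cite: BorelWallach2000, II §1.3 (1)–(2)] [cite: HarishChandra1953, §9] -/
theorem upq_sum_form_pPart_eq (B : V →ₗ⋆[ℂ] V →ₗ[ℂ] ℂ) (hskew : ∀ (Y : (uFormGroup α β).lie) (x y : V), B (ρ𝔤 Y x) y = -B x (ρ𝔤 Y y))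
    {c : ℂ} {u : V} (hc : upqCasimirOp ρ𝔤 u = c • u) :
    ∑ s, B (ρ𝔤 (upqPBasis s) u) (ρ𝔤 (upqPBasis s) u) = -(c * B u u) + ∑ a, B (ρ𝔤 (upqKVec α β a) u) (ρ𝔤 (upqKVec α β a) u) := by
  -- `Σ_s ρ(x_s)² = C + Σ_a ρ(w_a)²`
  have hsplit : (∑ s : (α × β) × Fin 2, ρ𝔤 (upqPBasis s) * ρ𝔤 (upqPBasis s)) =
      upqCasimirOp ρ𝔤 + ∑ a, ρ𝔤 (upqKVec α β a) * ρ𝔤 (upqKVec α β a) := by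
    rw [upqCasimirOp_eq ρ𝔤, sub_add_cancel]
  have happly := LinearMap.congr_fun hsplit u
  simp only [LinearMap.sum_apply, LinearMap.add_apply] at happly
  -- squares through skewness, termwise
  have hP' : ∑ s, B (ρ𝔤 (upqPBasis s) u) (ρ𝔤 (upqPBasis s) u) = ∑ s : (α × β) × Fin 2, -B u ((ρ𝔤 (upqPBasis s) * ρ𝔤 (upqPBasis s)) u) :=
    Finset.sum_congr rfl fun s _ => form_apply_apply_eq_neg B _ (hskew _) u
  have hK' : ∑ a, B (ρ𝔤 (upqKVec α β a) u) (ρ𝔤 (upqKVec α β a) u) = ∑ a, -B u ((ρ𝔤 (upqKVec α β a) * ρ𝔤 (upqKVec α β a)) u) :=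
    Finset.sum_congr rfl fun a _ => form_apply_apply_eq_neg B _ (hskew _) u
  rw [hP', hK', Finset.sum_neg_distrib, Finset.sum_neg_distrib, ← map_sum, happly, map_add, map_sum, hc, map_smul, smul_eq_mul]
  ring

/-- **Real parts** of the Casimir identity: `Σ_s Re B (ρ(x_s) u) (ρ(x_s) u) = −Re (c · B u u) + Σ_a Re B (ρ(w_a) u) (ρ(w_a) u)`.
[cite: BorelWallach2000, II §1.3 (1)–(2)] [cite: HarishChandra1953, §9] -/
theorem upq_sum_re_form_pPart_eq (B : V →ₗ⋆[ℂ] V →ₗ[ℂ] ℂ) (hskew : ∀ (Y : (uFormGroup α β).lie) (x y : V), B (ρ𝔤 Y x) y = -B x (ρ𝔤 Y y))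
    {c : ℂ} {u : V} (hc : upqCasimirOp ρ𝔤 u = c • u) :
    ∑ s, (B (ρ𝔤 (upqPBasis s) u) (ρ𝔤 (upqPBasis s) u)).re =
      -(c * B u u).re + ∑ a, (B (ρ𝔤 (upqKVec α β a) u) (ρ𝔤 (upqKVec α β a) u)).re := by
  have h := congrArg Complex.re (upq_sum_form_pPart_eq ρ𝔤 B hskew hc)
  rw [Complex.re_sum, Complex.add_re, Complex.neg_re, Complex.re_sum] at h
  exact h

/-- **One `𝔭`-letter is dominated by the `𝔨`-letters**: if moreover `Re B (D u) (D u) ≥ 0` for the letters (e.g. `B` positive), then for every `s`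
`Re B (ρ(x_s) u) (ρ(x_s) u) ≤ −Re (c · B u u) + Σ_a Re B (ρ(w_a) u) (ρ(w_a) u)`. [cite: Nelson1959, §2] [cite: HarishChandra1953, §9] -/
theorem re_form_upqPBasis_le (B : V →ₗ⋆[ℂ] V →ₗ[ℂ] ℂ) (hpos : ∀ x, 0 ≤ (B x x).re)
    (hskew : ∀ (Y : (uFormGroup α β).lie) (x y : V), B (ρ𝔤 Y x) y = -B x (ρ𝔤 Y y)) {c : ℂ} {u : V} (hc : upqCasimirOp ρ𝔤 u = c • u)
    (s : (α × β) × Fin 2) :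
    (B (ρ𝔤 (upqPBasis s) u) (ρ𝔤 (upqPBasis s) u)).re ≤
      -(c * B u u).re + ∑ a, (B (ρ𝔤 (upqKVec α β a) u) (ρ𝔤 (upqKVec α β a) u)).re := by
  rw [← upq_sum_re_form_pPart_eq ρ𝔤 B hskew hc]
  exact Finset.single_le_sum (f := fun s => (B (ρ𝔤 (upqPBasis s) u) (ρ𝔤 (upqPBasis s) u)).re) (fun s _ => hpos _) (Finset.mem_univ s)

end Literature.NumberTheory.Automorphic

end
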